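import Summits.AtomisticToContinuum.HydrodynamicLimit.Theorems.ImplosionDichotomyPolynomialCompressionSupFromEnergy
import Summits.AtomisticToContinuum.HydrodynamicLimit.Theorems.ImplosionDichotomyPolynomialCompressionShadowingDefs
import Summits.AtomisticToContinuum.HydrodynamicLimit.Theorems.ImplosionDichotomyPolynomialCompressionUniquenessIdentity

/-!
# From the level energies to pointwise bounds of `δV` and `∂δV` (closing of stub 4, part 2)

Helper file for the line `log-lipschitz-budget` of the crux `ImplosionDichotomy.PolynomialCompression`
(stmt-AtomisticToContinuum-12587), stub `stub_logBudgetShadowing`, blueprint §5 (the CLOSE: "Sobolev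
`H² ⊂ L^∞` turns `√(E₀ + ⋯ + E₃) ≤ σ³·poly` into the sup / `C¹` bounds of the bootstrap"). At a fixed time
`s` of a σ-solution `(ρ, u, θ)` (law `ζ`, smooth on an open `J ∋ ρ`) compared with a reference
`(ρ₁, u₁, θ₁)`, let the Friedrichs weights be bounded below, `A = shadowWeightA ≥ m_A > 0`,
`ρ ≥ m_ρ > 0`, `B = shadowWeightB ≥ m_B > 0`, and let the four level energies `shadowE0 … shadowE3` at
time `s` be `≤ ℰ`. Then, with THE Sobolev constant `K_S` of `sup_le_of_weighted_energies`, pointwise in `x`: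
`δρ² ≤ K_S m_A⁻¹ 6ℰ`, `‖δu‖² ≤ K_S m_ρ⁻¹ 6ℰ`, `δθ² ≤ K_S m_B⁻¹ 6ℰ`, and the same three bounds for every
first spatial derivative `∂ₗδρ, ∂ₗδu, ∂ₗδθ` (`lbClose_sup_bounds`). The only work is bookkeeping: each
weighted integral `∫ A (∂^α δρ)²`, … is at most twice the level energy of order `|α|` (the other two
components of the integrand are nonnegative), uniformly in the multi-index sums.
-/

noncomputable section

namespace Summit.AtomisticToContinuum.HydrodynamicLimit.Theorems

open Set MeasureTheory
open Literature.MathematicalPhysics.KineticTheory Literature.Analysis.FunctionSpaces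

/-! ### Pointwise and integrated comparison of one component with the full energy density -/

/-- Each of the three nonnegative components of `½(A a² + P n + B c²)` is at most twice the whole.
[folklore] -/
private theorem terms_le {A P B a n c : ℝ} (hA : 0 ≤ A) (hP : 0 ≤ P) (hB : 0 ≤ B) (hn : 0 ≤ n) :
    A * a ^ 2 ≤ 2 * (1 / 2 * (A * a ^ 2 + P * n + B * c ^ 2)) ∧
      P * n ≤ 2 * (1 / 2 * (A * a ^ 2 + P * n + B * c ^ 2)) ∧
        B * c ^ 2 ≤ 2 * (1 / 2 * (A * a ^ 2 + P * n + B * c ^ 2)) := by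
  have h1 : 0 ≤ A * a ^ 2 := by positivity
  have h2 : 0 ≤ P * n := by positivity
  have h3 : 0 ≤ B * c ^ 2 := by positivity
  refine ⟨by linarith, by linarith, by linarith⟩

/-- `∫ f ≤ 2 ∫ e` from `f ≤ 2e` pointwise, for continuous `f, e` on `𝕋³`. [folklore] -/
private theorem int_le {f e : T3 → ℝ} (hf : Continuous f) (he : Continuous e)
    (h : ∀ x, f x ≤ 2 * e x) : ∫ x, f x ≤ 2 * ∫ x, e x := by
  rw [← integral_const_mul]
  exact integral_mono hf.integrable_unitAddTorus (continuous_const.mul he).integrable_unitAddTorus h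

/-- `Σₗ ∫ fₗ ≤ 2 ∫ e` from `Σₗ fₗ ≤ 2e` pointwise. [folklore] -/
private theorem sum_int_le {f : Fin 3 → T3 → ℝ} {e : T3 → ℝ} (hf : ∀ l, Continuous (f l))
    (he : Continuous e) (h : ∀ x, ∑ l, f l x ≤ 2 * e x) : ∑ l, ∫ x, f l x ≤ 2 * ∫ x, e x := by
  rw [← integral_finsetSum _ fun l _ => (hf l).integrable_unitAddTorus]
  exact int_le (continuous_finsetSum _ fun l _ => hf l) he h

/-- `Σᵢ Σₗ ∫ fᵢₗ ≤ 2 ∫ e` from `Σᵢ Σₗ fᵢₗ ≤ 2e` pointwise. [folklore] -/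
private theorem sum_sum_int_le {f : Fin 3 → Fin 3 → T3 → ℝ} {e : T3 → ℝ}
    (hf : ∀ i l, Continuous (f i l)) (he : Continuous e) (h : ∀ x, ∑ i, ∑ l, f i l x ≤ 2 * e x) :
    ∑ i, ∑ l, ∫ x, f i l x ≤ 2 * ∫ x, e x := by
  have h1 : ∀ i, ∑ l, ∫ x, f i l x = ∫ x, ∑ l, f i l x := fun i =>
    (integral_finsetSum _ fun l _ => (hf i l).integrable_unitAddTorus).symm
  simp only [h1]
  exact sum_int_le (fun i => continuous_finsetSum _ fun l _ => hf i l) he h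

/-- `Σⱼ Σᵢ Σₗ ∫ fⱼᵢₗ ≤ 2 ∫ e` from `Σⱼ Σᵢ Σₗ fⱼᵢₗ ≤ 2e` pointwise. [folklore] -/
private theorem sum_sum_sum_int_le {f : Fin 3 → Fin 3 → Fin 3 → T3 → ℝ} {e : T3 → ℝ}
    (hf : ∀ j i l, Continuous (f j i l)) (he : Continuous e)
    (h : ∀ x, ∑ j, ∑ i, ∑ l, f j i l x ≤ 2 * e x) :
    ∑ j, ∑ i, ∑ l, ∫ x, f j i l x ≤ 2 * ∫ x, e x := by
  have h1 : ∀ j i, ∑ l, ∫ x, f j i l x = ∫ x, ∑ l, f j i l x := fun j i =>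
    (integral_finsetSum _ fun l _ => (hf j i l).integrable_unitAddTorus).symm
  simp only [h1]
  exact sum_sum_int_le (fun j i => continuous_finsetSum _ fun l _ => hf j i l) he h

/-! ### The three components of each level energy -/

section Levels

variable {A P B f h : T3 → ℝ} {g : T3 → V3} {E : ℝ}

/-- Level 0: `∫ A f², ∫ P ‖g‖², ∫ B h² ≤ 2E` when `∫ ½(A f² + P‖g‖² + B h²) ≤ E`. [folklore] -/
private theorem level0_parts (cA : Continuous A) (cP : Continuous P) (cB : Continuous B)
    (cf : Continuous f) (cg : Continuous g) (ch : Continuous h) (hA : ∀ x, 0 ≤ A x)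
    (hP : ∀ x, 0 ≤ P x) (hB : ∀ x, 0 ≤ B x)
    (hE : ∫ x, 1 / 2 * (A x * f x ^ 2 + P x * ‖g x‖ ^ 2 + B x * h x ^ 2) ≤ E) :
    ∫ x, A x * f x ^ 2 ≤ 2 * E ∧ ∫ x, P x * ‖g x‖ ^ 2 ≤ 2 * E ∧ ∫ x, B x * h x ^ 2 ≤ 2 * E := by
  have ce : Continuous fun x => 1 / 2 * (A x * f x ^ 2 + P x * ‖g x‖ ^ 2 + B x * h x ^ 2) :=
    continuous_const.mul (((cA.mul (cf.pow 2)).add (cP.mul (cg.norm.pow 2))).add (cB.mul (ch.pow 2)))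
  have hpt := fun x => terms_le (a := f x) (c := h x) (hA x) (hP x) (hB x) (sq_nonneg ‖g x‖)
  refine ⟨?_, ?_, ?_⟩
  · exact (int_le (cA.mul (cf.pow 2)) ce fun x => (hpt x).1).trans (by linarith)
  · exact (int_le (cP.mul (cg.norm.pow 2)) ce fun x => (hpt x).2.1).trans (by linarith)
  · exact (int_le (cB.mul (ch.pow 2)) ce fun x => (hpt x).2.2).trans (by linarith)

/-- Level 1: the three first-order weighted integrals are `≤ 2E`. [folklore] -/
private theorem level1_parts (cA : Continuous A) (cP : Continuous P) (cB : Continuous B)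
    (sf : Torus.IsSmooth f) (sg : Torus.IsSmooth g) (sh : Torus.IsSmooth h) (hA : ∀ x, 0 ≤ A x)
    (hP : ∀ x, 0 ≤ P x) (hB : ∀ x, 0 ≤ B x)
    (hE : ∫ x, ∑ l : Fin 3, 1 / 2 * (A x * (Torus.partialDeriv l f x) ^ 2 +
      P x * ‖Torus.partialDeriv l g x‖ ^ 2 + B x * (Torus.partialDeriv l h x) ^ 2) ≤ E) :
    (∑ l, ∫ x, A x * Torus.partialDeriv l f x ^ 2) ≤ 2 * E ∧
      (∑ l, ∫ x, P x * ‖Torus.partialDeriv l g x‖ ^ 2) ≤ 2 * E ∧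
        (∑ l, ∫ x, B x * Torus.partialDeriv l h x ^ 2) ≤ 2 * E := by
  have c1 : ∀ l, Continuous (Torus.partialDeriv l f) := fun l => (sf.partialDeriv l).continuous
  have c2 : ∀ l, Continuous (Torus.partialDeriv l g) := fun l => (sg.partialDeriv l).continuous
  have c3 : ∀ l, Continuous (Torus.partialDeriv l h) := fun l => (sh.partialDeriv l).continuous
  have ce : Continuous fun x => ∑ l : Fin 3, 1 / 2 * (A x * (Torus.partialDeriv l f x) ^ 2 +
      P x * ‖Torus.partialDeriv l g x‖ ^ 2 + B x * (Torus.partialDeriv l h x) ^ 2) :=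
    continuous_finsetSum _ fun l _ => continuous_const.mul
      (((cA.mul ((c1 l).pow 2)).add (cP.mul ((c2 l).norm.pow 2))).add (cB.mul ((c3 l).pow 2)))
  have hpt := fun x l => terms_le (a := Torus.partialDeriv l f x) (c := Torus.partialDeriv l h x)
    (hA x) (hP x) (hB x) (sq_nonneg ‖Torus.partialDeriv l g x‖)
  refine ⟨?_, ?_, ?_⟩
  · refine (sum_int_le (fun l => cA.mul ((c1 l).pow 2)) ce fun x => ?_).trans (by linarith)
    rw [Finset.mul_sum]
    exact Finset.sum_le_sum fun l _ => (hpt x l).1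
  · refine (sum_int_le (fun l => cP.mul ((c2 l).norm.pow 2)) ce fun x => ?_).trans (by linarith)
    rw [Finset.mul_sum]
    exact Finset.sum_le_sum fun l _ => (hpt x l).2.1
  · refine (sum_int_le (fun l => cB.mul ((c3 l).pow 2)) ce fun x => ?_).trans (by linarith)
    rw [Finset.mul_sum]
    exact Finset.sum_le_sum fun l _ => (hpt x l).2.2

/-- Level 2: the three second-order weighted integrals are `≤ 2E`. [folklore] -/
private theorem level2_parts (cA : Continuous A) (cP : Continuous P) (cB : Continuous B)
    (sf : Torus.IsSmooth f) (sg : Torus.IsSmooth g) (sh : Torus.IsSmooth h) (hA : ∀ x, 0 ≤ A x)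
    (hP : ∀ x, 0 ≤ P x) (hB : ∀ x, 0 ≤ B x)
    (hE : ∫ x, ∑ i : Fin 3, ∑ l : Fin 3, 1 / 2 *
      (A x * (Torus.partialDeriv i (Torus.partialDeriv l f) x) ^ 2 +
        P x * ‖Torus.partialDeriv i (Torus.partialDeriv l g) x‖ ^ 2 +
        B x * (Torus.partialDeriv i (Torus.partialDeriv l h) x) ^ 2) ≤ E) :
    (∑ i, ∑ l, ∫ x, A x * Torus.partialDeriv i (Torus.partialDeriv l f) x ^ 2) ≤ 2 * E ∧
      (∑ i, ∑ l, ∫ x, P x * ‖Torus.partialDeriv i (Torus.partialDeriv l g) x‖ ^ 2) ≤ 2 * E ∧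
        (∑ i, ∑ l, ∫ x, B x * Torus.partialDeriv i (Torus.partialDeriv l h) x ^ 2) ≤ 2 * E := by
  have c1 : ∀ i l, Continuous (Torus.partialDeriv i (Torus.partialDeriv l f)) := fun i l =>
    ((sf.partialDeriv l).partialDeriv i).continuous
  have c2 : ∀ i l, Continuous (Torus.partialDeriv i (Torus.partialDeriv l g)) := fun i l =>
    ((sg.partialDeriv l).partialDeriv i).continuous
  have c3 : ∀ i l, Continuous (Torus.partialDeriv i (Torus.partialDeriv l h)) := fun i l =>
    ((sh.partialDeriv l).partialDeriv i).continuous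
  have ce : Continuous fun x => ∑ i : Fin 3, ∑ l : Fin 3, 1 / 2 *
      (A x * (Torus.partialDeriv i (Torus.partialDeriv l f) x) ^ 2 +
        P x * ‖Torus.partialDeriv i (Torus.partialDeriv l g) x‖ ^ 2 +
        B x * (Torus.partialDeriv i (Torus.partialDeriv l h) x) ^ 2) :=
    continuous_finsetSum _ fun i _ => continuous_finsetSum _ fun l _ => continuous_const.mul
      (((cA.mul ((c1 i l).pow 2)).add (cP.mul ((c2 i l).norm.pow 2))).add (cB.mul ((c3 i l).pow 2)))
  have hpt := fun x i l => terms_le (a := Torus.partialDeriv i (Torus.partialDeriv l f) x)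
    (c := Torus.partialDeriv i (Torus.partialDeriv l h) x) (hA x) (hP x) (hB x)
    (sq_nonneg ‖Torus.partialDeriv i (Torus.partialDeriv l g) x‖)
  refine ⟨?_, ?_, ?_⟩
  · refine (sum_sum_int_le (fun i l => cA.mul ((c1 i l).pow 2)) ce fun x => ?_).trans (by linarith)
    rw [Finset.mul_sum]
    exact Finset.sum_le_sum fun i _ => by
      rw [Finset.mul_sum]; exact Finset.sum_le_sum fun l _ => (hpt x i l).1
  · refine (sum_sum_int_le (fun i l => cP.mul ((c2 i l).norm.pow 2)) ce fun x => ?_).trans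
      (by linarith)
    rw [Finset.mul_sum]
    exact Finset.sum_le_sum fun i _ => by
      rw [Finset.mul_sum]; exact Finset.sum_le_sum fun l _ => (hpt x i l).2.1
  · refine (sum_sum_int_le (fun i l => cB.mul ((c3 i l).pow 2)) ce fun x => ?_).trans (by linarith)
    rw [Finset.mul_sum]
    exact Finset.sum_le_sum fun i _ => by
      rw [Finset.mul_sum]; exact Finset.sum_le_sum fun l _ => (hpt x i l).2.2

/-- Level 3: the three third-order weighted integrals are `≤ 2E`. [folklore] -/
private theorem level3_parts (cA : Continuous A) (cP : Continuous P) (cB : Continuous B)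
    (sf : Torus.IsSmooth f) (sg : Torus.IsSmooth g) (sh : Torus.IsSmooth h) (hA : ∀ x, 0 ≤ A x)
    (hP : ∀ x, 0 ≤ P x) (hB : ∀ x, 0 ≤ B x)
    (hE : ∫ x, ∑ j : Fin 3, ∑ i : Fin 3, ∑ l : Fin 3, 1 / 2 *
      (A x * (Torus.partialDeriv j (Torus.partialDeriv i (Torus.partialDeriv l f)) x) ^ 2 +
        P x * ‖Torus.partialDeriv j (Torus.partialDeriv i (Torus.partialDeriv l g)) x‖ ^ 2 +
        B x * (Torus.partialDeriv j (Torus.partialDeriv i (Torus.partialDeriv l h)) x) ^ 2) ≤ E) :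
    (∑ j, ∑ i, ∑ l, ∫ x, A x *
        Torus.partialDeriv j (Torus.partialDeriv i (Torus.partialDeriv l f)) x ^ 2) ≤ 2 * E ∧
      (∑ j, ∑ i, ∑ l, ∫ x, P x *
        ‖Torus.partialDeriv j (Torus.partialDeriv i (Torus.partialDeriv l g)) x‖ ^ 2) ≤ 2 * E ∧
      (∑ j, ∑ i, ∑ l, ∫ x, B x *
        Torus.partialDeriv j (Torus.partialDeriv i (Torus.partialDeriv l h)) x ^ 2) ≤ 2 * E := by
  have c1 : ∀ j i l, Continuous
      (Torus.partialDeriv j (Torus.partialDeriv i (Torus.partialDeriv l f))) := fun j i l =>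
    (((sf.partialDeriv l).partialDeriv i).partialDeriv j).continuous
  have c2 : ∀ j i l, Continuous
      (Torus.partialDeriv j (Torus.partialDeriv i (Torus.partialDeriv l g))) := fun j i l =>
    (((sg.partialDeriv l).partialDeriv i).partialDeriv j).continuous
  have c3 : ∀ j i l, Continuous
      (Torus.partialDeriv j (Torus.partialDeriv i (Torus.partialDeriv l h))) := fun j i l =>
    (((sh.partialDeriv l).partialDeriv i).partialDeriv j).continuous
  have ce : Continuous fun x => ∑ j : Fin 3, ∑ i : Fin 3, ∑ l : Fin 3, 1 / 2 *
      (A x * (Torus.partialDeriv j (Torus.partialDeriv i (Torus.partialDeriv l f)) x) ^ 2 +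
        P x * ‖Torus.partialDeriv j (Torus.partialDeriv i (Torus.partialDeriv l g)) x‖ ^ 2 +
        B x * (Torus.partialDeriv j (Torus.partialDeriv i (Torus.partialDeriv l h)) x) ^ 2) :=
    continuous_finsetSum _ fun j _ => continuous_finsetSum _ fun i _ =>
      continuous_finsetSum _ fun l _ => continuous_const.mul
        (((cA.mul ((c1 j i l).pow 2)).add (cP.mul ((c2 j i l).norm.pow 2))).add
          (cB.mul ((c3 j i l).pow 2)))
  have hpt := fun x j i l =>
    terms_le (a := Torus.partialDeriv j (Torus.partialDeriv i (Torus.partialDeriv l f)) x)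
      (c := Torus.partialDeriv j (Torus.partialDeriv i (Torus.partialDeriv l h)) x) (hA x) (hP x)
      (hB x) (sq_nonneg ‖Torus.partialDeriv j (Torus.partialDeriv i (Torus.partialDeriv l g)) x‖)
  refine ⟨?_, ?_, ?_⟩
  · refine (sum_sum_sum_int_le (fun j i l => cA.mul ((c1 j i l).pow 2)) ce fun x => ?_).trans
      (by linarith)
    rw [Finset.mul_sum]
    exact Finset.sum_le_sum fun j _ => by
      rw [Finset.mul_sum]
      exact Finset.sum_le_sum fun i _ => by
        rw [Finset.mul_sum]; exact Finset.sum_le_sum fun l _ => (hpt x j i l).1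
  · refine (sum_sum_sum_int_le (fun j i l => cP.mul ((c2 j i l).norm.pow 2)) ce fun x => ?_).trans
      (by linarith)
    rw [Finset.mul_sum]
    exact Finset.sum_le_sum fun j _ => by
      rw [Finset.mul_sum]
      exact Finset.sum_le_sum fun i _ => by
        rw [Finset.mul_sum]; exact Finset.sum_le_sum fun l _ => (hpt x j i l).2.1
  · refine (sum_sum_sum_int_le (fun j i l => cB.mul ((c3 j i l).pow 2)) ce fun x => ?_).trans
      (by linarith)
    rw [Finset.mul_sum]
    exact Finset.sum_le_sum fun j _ => by
      rw [Finset.mul_sum]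
      exact Finset.sum_le_sum fun i _ => by
        rw [Finset.mul_sum]; exact Finset.sum_le_sum fun l _ => (hpt x j i l).2.2

end Levels

/-! ### The pointwise bounds -/

/-- **Pointwise bounds of `δV` and `∂δV` from the level energies.** There is ONE constant `K_S > 0`
(the Sobolev constant of `sup_le_of_weighted_energies`) such that for every σ-solution `(ρ, u, θ)` with
law `ζ` smooth on an open `J ∋ ρ` and every reference solution `(ρ₁, u₁, θ₁)` on `[0, T)`, at every time
`s ∈ [0, T)` at which the weights are bounded below (`shadowWeightA ≥ m_A > 0`, `ρ ≥ m_ρ > 0`,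
`shadowWeightB ≥ m_B > 0`) and the level energies `shadowE0 … shadowE3` are `≤ ℰ`, one has for all `x`
and all directions `l`: `δρ², (∂ₗδρ)² ≤ K_S m_A⁻¹ (6ℰ)`, `‖δu‖², ‖∂ₗδu‖² ≤ K_S m_ρ⁻¹ (6ℰ)`,
`δθ², (∂ₗδθ)² ≤ K_S m_B⁻¹ (6ℰ)`. [folklore] -/
theorem lbClose_sup_bounds :
    ∃ KS : ℝ, 0 < KS ∧ ∀ {σ σ₁ T : ℝ} {ρ θ ρ₁ θ₁ : ℝ → T3 → ℝ} {u u₁ : ℝ → T3 → V3} {ζ : ℝ → ℝ}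
      {J : Set ℝ} {s mA mρ mB ℰ : ℝ},
      IsHardSphereEulerSolution σ T ρ u θ → IsHardSphereEulerSolution σ₁ T ρ₁ u₁ θ₁ → IsOpen J →
      ContDiffOn ℝ (⊤ : ℕ∞) ζ J → (∀ t ∈ Ico 0 T, ∀ x, ρ t x ∈ J) → s ∈ Ico 0 T →
      0 < mA → 0 < mρ → 0 < mB → (∀ x, mA ≤ shadowWeightA ζ ρ θ s x) → (∀ x, mρ ≤ ρ s x) →
      (∀ x, mB ≤ shadowWeightB ρ θ s x) →
      shadowE0 ζ ρ θ u ρ₁ θ₁ u₁ s ≤ ℰ → shadowE1 ζ ρ θ u ρ₁ θ₁ u₁ s ≤ ℰ →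
      shadowE2 ζ ρ θ u ρ₁ θ₁ u₁ s ≤ ℰ → shadowE3 ζ ρ θ u ρ₁ θ₁ u₁ s ≤ ℰ →
      ∀ x, (ρ s x - ρ₁ s x) ^ 2 ≤ KS * mA⁻¹ * (6 * ℰ) ∧ ‖u s x - u₁ s x‖ ^ 2 ≤ KS * mρ⁻¹ * (6 * ℰ) ∧
        (θ s x - θ₁ s x) ^ 2 ≤ KS * mB⁻¹ * (6 * ℰ) ∧
        ∀ l : Fin 3, (Torus.partialDeriv l (fun y => ρ s y - ρ₁ s y) x) ^ 2 ≤ KS * mA⁻¹ * (6 * ℰ) ∧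
          ‖Torus.partialDeriv l (fun y => u s y - u₁ s y) x‖ ^ 2 ≤ KS * mρ⁻¹ * (6 * ℰ) ∧
          (Torus.partialDeriv l (fun y => θ s y - θ₁ s y) x) ^ 2 ≤ KS * mB⁻¹ * (6 * ℰ) := by
  obtain ⟨KS, hKS, M3r, M3v, M2r, M2v⟩ := sup_le_of_weighted_energies
  refine ⟨KS, hKS, ?_⟩
  intro σ σ₁ T ρ θ ρ₁ θ₁ u u₁ ζ J s mA mρ mB ℰ hE hE₁ hJ hζ hρJ hs hmA hmρ hmB hA hP hB h0 h1 h2 h3 x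
  -- regularity of the slices at time `s`
  have cA : Continuous (shadowWeightA ζ ρ θ s) :=
    ((isSmoothSpaceTimeOn_weightA hE hJ hζ hρJ).isSmooth_slice hs).continuous
  have cB : Continuous (shadowWeightB ρ θ s) :=
    ((isSmoothSpaceTimeOn_weightB hE).isSmooth_slice hs).continuous
  have cP : Continuous (ρ s) := (hE.smooth_density.isSmooth_slice hs).continuous
  have sf : Torus.IsSmooth (fun y => ρ s y - ρ₁ s y) :=
    (hE.smooth_density.sub hE₁.smooth_density).isSmooth_slice hs
  have sg : Torus.IsSmooth (fun y => u s y - u₁ s y) :=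
    (hE.smooth_velocity.sub hE₁.smooth_velocity).isSmooth_slice hs
  have sh : Torus.IsSmooth (fun y => θ s y - θ₁ s y) :=
    (hE.smooth_temperature.sub hE₁.smooth_temperature).isSmooth_slice hs
  have hA0 : ∀ y, 0 ≤ shadowWeightA ζ ρ θ s y := fun y => hmA.le.trans (hA y)
  have hP0 : ∀ y, 0 ≤ ρ s y := fun y => hmρ.le.trans (hP y)
  have hB0 : ∀ y, 0 ≤ shadowWeightB ρ θ s y := fun y => hmB.le.trans (hB y)
  -- the twelve weighted integrals are `≤ 2ℰ`
  unfold shadowE0 at h0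
  unfold shadowE1 at h1
  unfold shadowE2 at h2
  unfold shadowE3 at h3
  obtain ⟨a0, p0, b0⟩ := level0_parts (f := fun y => ρ s y - ρ₁ s y) (g := fun y => u s y - u₁ s y)
    (h := fun y => θ s y - θ₁ s y) cA cP cB sf.continuous sg.continuous sh.continuous hA0 hP0 hB0 h0
  obtain ⟨a1, p1, b1⟩ := level1_parts cA cP cB sf sg sh hA0 hP0 hB0 h1
  obtain ⟨a2, p2, b2⟩ := level2_parts cA cP cB sf sg sh hA0 hP0 hB0 h2
  obtain ⟨a3, p3, b3⟩ := level3_parts cA cP cB sf sg sh hA0 hP0 hB0 h3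
  have kA : 0 ≤ KS * mA⁻¹ := by positivity
  have kP : 0 ≤ KS * mρ⁻¹ := by positivity
  have kB : 0 ≤ KS * mB⁻¹ := by positivity
  refine ⟨?_, ?_, ?_, fun l => ⟨?_, ?_, ?_⟩⟩
  · refine (M3r cA hmA hA sf x).trans ?_
    exact mul_le_mul_of_nonneg_left (by linarith) kA
  · refine (M3v cP hmρ hP sg x).trans ?_
    exact mul_le_mul_of_nonneg_left (by linarith) kP
  · refine (M3r cB hmB hB sh x).trans ?_
    exact mul_le_mul_of_nonneg_left (by linarith) kB
  · refine (M2r cA hmA hA sf l x).trans ?_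
    exact mul_le_mul_of_nonneg_left (by linarith) kA
  · refine (M2v cP hmρ hP sg l x).trans ?_
    exact mul_le_mul_of_nonneg_left (by linarith) kP
  · refine (M2r cB hmB hB sh l x).trans ?_
    exact mul_le_mul_of_nonneg_left (by linarith) kB

end Summit.AtomisticToContinuum.HydrodynamicLimit.Theorems

end
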